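import Mathlib.CategoryTheory.Galois.Topology
import Mathlib.Topology.Algebra.ContinuousMonoidHom
import HarnessLib

/-!
# Transport of basepoints (fibre functors) along an equivalence of categories: `π₁` is unchanged

[GeoAn] §1.1 p. 9 / Def. 1.1.2 (ii): a basepoint of a connected anabelioid `X` is an exact functor
`β : X → Ens_f`, and `π₁(X, β) := Aut(β)` (a profinite group; Mathlib's topological group `Aut F` of
`CategoryTheory.Galois.Topology`); [SGA1] Exp. V §4–§5.  Mathlib-level plumbing for the abc-iut cell's
anabelioid dictionary (campaign-L R1, GAP row G-L4t14-R1; seat abc-iut-f-072): for an equivalence of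
categories `e : C ≌ D` and ANY functor `F : D ⥤ FintypeCat`, pulling the basepoint back along `e` does not
change the fundamental group —

* `autMulEquivWhiskerLeft e F : Aut F ≃* Aut (e.functor ⋙ F)`, `σ ↦ e.functor ◁ σ`
  (Mathlib `Equivalence.congrLeft` + `Functor.FullyFaithful.autMulEquivOfFullyFaithful`), with
  `autMulEquivWhiskerLeft_apply_app : (… σ).hom.app X = σ.hom.app (e.functor.obj X)` (`rfl`);
* `autContinuousMulEquivWhiskerLeft e F : Aut F ≃ₜ* Aut (e.functor ⋙ F)` — the same as an isomorphism
  of TOPOLOGICAL groups for Mathlib's profinite topologies on `Aut F` (continuity coordinatewise through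
  `PreGaloisCategory.autEmbedding`; the inverse by compact → Hausdorff), cf. Mathlib's
  `PreGaloisCategory.autEquivAutWhiskerRight` for whiskering on the other side.

Two definitions (the isomorphisms) + their computation rules; no instance, no named fact; nothing here bears
on [IUTchIII] Cor. 3.12.
-/

noncomputable section

open CategoryTheory CategoryTheory.PreGaloisCategory Topology

universe u₁ u₂ v₁ v₂ w

namespace Literature.AnabelianGeometry.Anabelioids

variable {C : Type u₁} [Category.{v₁} C] {D : Type u₂} [Category.{v₂} D]

/-- **Pull-back of a basepoint along an equivalence, on `π₁`** (abstract groups): for `e : C ≌ D` and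
`F : D ⥤ FintypeCat`, whiskering `σ ↦ e.functor ◁ σ` is a group isomorphism `Aut F ≃* Aut (e.functor ⋙ F)`
(the whiskering functor `Equivalence.congrLeft` is fully faithful). [cite: MochizukiGeoAn2004, §1.1 p.9] -/
def autMulEquivWhiskerLeft (e : C ≌ D) (F : D ⥤ FintypeCat.{w}) : Aut F ≃* Aut (e.functor ⋙ F) :=
  (e.symm.congrLeft (E := FintypeCat.{w})).fullyFaithfulFunctor.autMulEquivOfFullyFaithful F

/-- Components of the transported automorphism: `(e.functor ◁ σ)_X = σ_{e X}`.
[cite: MochizukiGeoAn2004, §1.1 p.9] -/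
@[simp] theorem autMulEquivWhiskerLeft_apply_app (e : C ≌ D) (F : D ⥤ FintypeCat.{w}) (σ : Aut F)
    (X : C) : (autMulEquivWhiskerLeft e F σ).hom.app X = σ.hom.app (e.functor.obj X) := rfl

/-- The whiskering isomorphism is continuous for the profinite topologies on `Aut`.
[cite: MochizukiGeoAn2004, §1.1 p.9] -/
theorem continuous_autMulEquivWhiskerLeft (e : C ≌ D) (F : D ⥤ FintypeCat.{w}) :
    Continuous (autMulEquivWhiskerLeft e F) := by
  rw [(autEmbedding_isClosedEmbedding _).isInducing.continuous_iff, continuous_pi_iff]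
  intro X
  change Continuous fun a ↦ autEmbedding F a (e.functor.obj X)
  fun_prop

/-- **Pull-back of a basepoint along an equivalence, on `π₁`** (topological groups):
`Aut F ≃ₜ* Aut (e.functor ⋙ F)` — an equivalence of categories does not change the fundamental group at
corresponding basepoints. [cite: MochizukiGeoAn2004, §1.1 p.9] -/
def autContinuousMulEquivWhiskerLeft (e : C ≌ D) (F : D ⥤ FintypeCat.{w}) :
    Aut F ≃ₜ* Aut (e.functor ⋙ F) where
  __ := autMulEquivWhiskerLeft e F
  continuous_toFun := continuous_autMulEquivWhiskerLeft e F
  continuous_invFun := Continuous.continuous_symm_of_equiv_compact_to_t2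
    (f := (autMulEquivWhiskerLeft e F).toEquiv) (continuous_autMulEquivWhiskerLeft e F)

/-- Components of the topological transport: `(… σ)_X = σ_{e X}`. [cite: MochizukiGeoAn2004, §1.1 p.9] -/
@[simp] theorem autContinuousMulEquivWhiskerLeft_apply_app (e : C ≌ D) (F : D ⥤ FintypeCat.{w})
    (σ : Aut F) (X : C) :
    (autContinuousMulEquivWhiskerLeft e F σ).hom.app X = σ.hom.app (e.functor.obj X) := rfl

end Literature.AnabelianGeometry.Anabelioids
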